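import Summits.Ventures.HSemireg.WedgeHankelClassMapMatrix
import Summits.Ventures.HSemireg.WedgeHankelCoSiegelTower

/-!
# Venture HSemireg — WHICH SUB-BOX CLASSES ARE SIEGEL FORMS: for `k ≤ N` the class `w_k(c)` of the first `k` pairs lies in the Siegel ideal `SI_k` of the box
# **iff `C(k,j) · c_j = 0` in `K` for every `j ≤ k`** — over a field where the `C(k,j)` are units: iff its window vanishes (I16's top-degree statement, now for every sub-box degree and
# WITHOUT the unit hypothesis); in characteristic `p`: exactly the windows supported on `{j : p ∣ C(k,j)}` (e.g. `E_1 = s_{01}` for `k = 2` in characteristic `2`)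

HONEST FRAMING. Part of the Lean index of the computation cell `pub-hsemireg` (seat p10 gen 24, Sunday typer «UNIFORM-IN-n»).
Finite-dimensional EXTERIOR ALGEBRA over a field + th-7's apolar pairing ONLY: no variety, no cohomology theory, no sheaf, no Ext group, no semiregularity map;
nothing here says that HC / HC_CM / HC_AV holds; no Literature fact is declared or used.  Custodian versions as in `WedgeHankelSiegelIdeal` (1/3); dictionary QUOTED, never asserted.

WHAT IS IN THE TREE.  M8 (this seat, `WedgeHankelClassMapMatrix`): `w_mul_w_top_eq_zero_iff_vecMul_hankel1`, `vecMul_twist_hankel1_apply`; G6 (`WedgeHankelCoSiegelTower`):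
`siegelIdeal_eq_iInf_Kr_w` (`SI_k = ⋂_q Kr(univ, w_N q, k)`, `k ≤ N`); gen 11 `mul_w_eq_zero_of_mem_siegelIdeal`; I16 (`WedgeApolarSpikes`): `w_mem_siegelIdeal_iff_window_zero` (the `n`-box top
degree, under «all `C(n,p)` units») and `coSiegel_inf_siegelIdeal_eq_bot`.
THIS FILE (namespace `Summit.Ventures.HSemireg.Wedge.HankelOuter` continued; imports M8 and G6):
* §422 `vecMul_twist_hankel1_spike_zero` (against the spike `δ_r` the `t = 0` entry of the twisted row is `(−1)^r C(k,r) c_{k−r}`), `w_sub_mem_Hom_univ`,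
  **`w_mem_siegelIdeal_iff_forall_choose_mul`** (`w K N k c ∈ SI_k ↔ ∀ j ≤ k, C(k,j)·c_j = 0`, every field, `k ≤ N`), `w_sub_mem_siegelIdeal_iff_window_zero` (all `C(k,j)` units: iff the
  window vanishes), **`w_spike_sub_mem_siegelIdeal_iff`** (the sub-box spike class `w_k(δ_j)`, `j ≤ k`, is a Siegel `k`-form iff `C(k,j) = 0` in `K`).
READING: M8's universal twist `c_{k−r} ↦ (−1)^r C(k,r) c_{k−r}` has kernel exactly the Siegel sub-box classes; so over a field with `k!` a unit the `k + 1` sub-box classes meet `SI_k`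
trivially and (L8: `dim (SI_k ⊓ pure piece) = 2^k − (k+1)`) span a complement of the Siegel piece — M8 is then a statement about ALL of `⋀^k / SI_k` on that piece.  Nothing Ext-side.
New names only.
-/

open Module

namespace Summit.Ventures.HSemireg.Wedge.HankelOuter

open Summit.Ventures.HSemireg.Wedge Summit.Ventures.HSemireg.Wedge.Kunneth Summit.Ventures.HSemireg.Wedge.Hankel
  Summit.Ventures.HSemireg.Wedge.BasisFree Summit.Ventures.HSemireg.Wedge.HankelSiegel Summit.Ventures.HSemireg.Wedge.HankelSiegelIdeal
  Summit.Ventures.HSemireg.Wedge.KunnethKernel Summit.Ventures.HSemireg.Wedge.HankelFrameChange Summit.Ventures.HSemireg.Wedge.KernelDuality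

variable (K : Type*) [Field K] {N : ℕ}

/-! ## §422. Which sub-box classes are Siegel forms -/

/-- against the spike `δ_r` (`r ≤ k ≤ N`), the `t = 0` entry of the twisted row: `((r′ ↦ (−1)^{r′} C(k,r′) c_{k−r′}) ᵥ* H_k(δ_r)) 0 = (−1)^r C(k,r) c_{k−r}`. -/
theorem vecMul_twist_hankel1_spike_zero {k : ℕ} (hk : k ≤ N) (c : ℕ → K) (r : Fin (k + 1)) :
    Matrix.vecMul (fun r' : Fin (k + 1) => (-1) ^ (r' : ℕ) * (k.choose (r' : ℕ) : K) * c (k - (r' : ℕ)))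
        (hankel1 K N k (fun j => if j = (r : ℕ) then (1 : K) else 0)) ⟨0, by omega⟩
      = (-1) ^ (r : ℕ) * (k.choose (r : ℕ) : K) * c (k - (r : ℕ)) := by
  rw [vecMul_twist_hankel1_apply, Finset.sum_eq_single (r : ℕ)]
  · simp only [add_zero, if_true, mul_one]
  · intro r' _ hr'
    simp only [add_zero, if_neg hr', mul_zero]
  · intro h
    exact absurd (Finset.mem_range.mpr r.2) h

/-- the sub-box class is a `k`-form of the box: `w K N k c ∈ Hom(univ, k)` (`k ≤ N`). -/
theorem w_sub_mem_Hom_univ {k : ℕ} (hk : k ≤ N) (c : ℕ → K) : w K N k c ∈ Hom K (In N) Finset.univ k :=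
  Hom_mono K (Finset.subset_univ _) k (w_mem_Hom K hk c)

/-- **WHICH SUB-BOX CLASSES ARE SIEGEL FORMS: `w K N k c ∈ SI_k ↔ ∀ j ≤ k, C(k,j) · c_j = 0` in `K`** (`k ≤ N`, every field, every window `c`): `SI_k = ⋂_q Kr(w_N q)` (G6), the class
kills `w_N(q)` iff its twisted window is in the left kernel of `H_k(q)` (M8), and the spikes `δ_r` test the twisted coordinates one by one. -/
theorem w_mem_siegelIdeal_iff_forall_choose_mul {k : ℕ} (hk : k ≤ N) (c : ℕ → K) :
    w K N k c ∈ siegelIdeal K N k ↔ ∀ j ≤ k, (k.choose j : K) * c j = 0 := by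
  constructor
  · intro hS j hj
    have h0 := mul_w_eq_zero_of_mem_siegelIdeal K hS (fun i => if i = k - j then (1 : K) else 0)
    rw [w_mul_w_top_eq_zero_iff_vecMul_hankel1 K hk] at h0
    have h1 := congr_fun h0 ⟨0, by omega⟩
    rw [vecMul_twist_hankel1_spike_zero K hk c ⟨k - j, by omega⟩, Pi.zero_apply] at h1
    simp only [mul_eq_zero, pow_eq_zero_iff', neg_eq_zero, one_ne_zero, ne_eq, false_and, false_or] at h1
    rw [Nat.choose_symm hj, Nat.sub_sub_self hj] at h1
    exact mul_eq_zero.mpr h1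
  · intro h
    rw [siegelIdeal_eq_iInf_Kr_w K hk, Submodule.mem_iInf]
    intro q
    refine mem_Kr.mpr ⟨w_sub_mem_Hom_univ K hk c, ?_⟩
    rw [w_mul_w_top_eq_zero_iff_vecMul_hankel1 K hk]
    have hv : (fun r : Fin (k + 1) => (-1) ^ (r : ℕ) * (k.choose (r : ℕ) : K) * c (k - (r : ℕ))) = 0 := by
      funext r
      have hr := r.2
      have h1 := h (k - (r : ℕ)) (Nat.sub_le k r)
      rw [Nat.choose_symm (by omega : (r : ℕ) ≤ k)] at h1
      rw [Pi.zero_apply, mul_assoc, h1, mul_zero]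
    rw [hv, Matrix.zero_vecMul]

/-- all `C(k,j)` units (`j ≤ k`): **`w K N k c ∈ SI_k ↔` the window `c_0, …, c_k` vanishes** (I16's statement for every sub-box degree `k ≤ N`). -/
theorem w_sub_mem_siegelIdeal_iff_window_zero {k : ℕ} (hk : k ≤ N) (hK : ∀ j ≤ k, (k.choose j : K) ≠ 0) (c : ℕ → K) :
    w K N k c ∈ siegelIdeal K N k ↔ ∀ j ≤ k, c j = 0 := by
  rw [w_mem_siegelIdeal_iff_forall_choose_mul K hk]
  exact forall_congr' fun j => forall_congr' fun hj => by rw [mul_eq_zero, or_iff_right (hK j hj)]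

/-- **THE SUB-BOX SPIKE CLASS `w_k(δ_j)` (`j ≤ k ≤ N`) IS A SIEGEL `k`-FORM IFF `C(k,j) = 0` in `K`** — never in characteristic `0` or `> k`; e.g. `k = 2`, `j = 1` in characteristic `2`
(I16's `E_1 = s_{01}`). -/
theorem w_spike_sub_mem_siegelIdeal_iff {k : ℕ} (hk : k ≤ N) {j : ℕ} (hj : j ≤ k) :
    w K N k (fun i => if i = j then (1 : K) else 0) ∈ siegelIdeal K N k ↔ (k.choose j : K) = 0 := by
  rw [w_mem_siegelIdeal_iff_forall_choose_mul K hk]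
  constructor
  · intro h
    have := h j hj
    rwa [if_pos rfl, mul_one] at this
  · intro h j' hj'
    by_cases e : j' = j
    · rw [e, h, zero_mul]
    · rw [if_neg e, mul_zero]

end Summit.Ventures.HSemireg.Wedge.HankelOuter
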